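import Summits.QuantumFields.YangMills.Theses.F4SubCurvatureDoor
import Summits.QuantumFields.YangMills.Theorems.F4SubCurvatureDoorSubCurvatureKernelContinuousVersion
import HarnessLib

/-!
# Route `F4SubCurvatureDoor` — child `ContinuousKernel` ⟨stmt-QuantumFields-23762⟩ of `SubCurvatureKernel` ⟨stmt-QuantumFields-23036⟩, BY NAME.

The body of the child is LETTER-FOR-LETTER ✓`continuousKernel_of_offDiagLimitAlong` (p741016, free hands ym-line-frs-p2 g18:
mollified OS matrix coefficients ⇒ Laplace–Fourier measure ⇒ vague cluster point ⇒ half-space continuity ⇒ W(B₄) glue).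
Prepared by planner ym-idea-3 g23 after filing the split (route rev 3); to be filed by a PROVER with
`--workitem stmt-QuantumFields-23762`.
HONEST LABEL: the SOFT child only; `SubCurvatureClause` ⟨23763⟩ (asymptotic freedom) is THE crux and is untouched; ⟨23036⟩ stays open;
the Yang–Mills mass gap is NOT proved; no summit is proved by a line.
-/

open Filter Topology MeasureTheory
open Summit.QuantumFields.YangMills.Theorems.F4SubCurvatureDoorSubCurvatureKernelContinuousVersion
  (continuousKernel_of_offDiagLimitAlong)

namespace Summit.QuantumFields.YangMills.Theorems.F4SubCurvatureDoorContinuousKernel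

/-- ⟨stmt-QuantumFields-23762⟩ by name. -/
theorem continuousKernel_proof : Summit.QuantumFields.YangMills.Theses.F4SubCurvatureDoor.ContinuousKernel := by
  intro G _ _ _ _ hG
  letI : MeasurableSpace G := borel G
  haveI : BorelSpace G := ⟨rfl⟩
  intro r a hapos ha0 hMB sch hsch φ hφ S₁ hS₁
  exact continuousKernel_of_offDiagLimitAlong r hapos ha0 hMB hsch hφ hS₁

end Summit.QuantumFields.YangMills.Theorems.F4SubCurvatureDoorContinuousKernel
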